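import Mathlib.Probability.Independence.BoundedContinuousFunction
import Mathlib.Probability.Independence.Integration
import Literature.Probability.Percolation.QuadCrossingNoise
import Literature.Probability.Percolation.QuadCrossingNoiseDiscrete
import Literature.Probability.Percolation.QuadCrossingSubseqLimits
import Literature.Probability.Percolation.QuadCrossingPushforward
import HarnessLib

/-!
# Schramm–Smirnov 2011, Cor. 1.8: the independence half of the noise property, proved

Topic `Literature/Probability/Percolation`; proofs file for the named facts
`SchrammSmirnov2011_cor_1_8_noise` and `SchrammSmirnov2011_cor_1_8_black` of
`QuadCrossingNoise.lean` (O. Schramm, S. Smirnov, *On the scaling limits of planar percolation*,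
Ann. Probab. 39 (2011) 1768–1814, arXiv:1101.5820, Cor. 1.8 "Percolation is a noise": for every
`W` of the rectangle base the `σ`-fields `𝓕_{int(D ∩ W)}` and `𝓕_{int(D ∖ W)}` of a subsequential
scaling limit are (i) independent and (ii) generate the Borel `σ`-field up to null sets).

Half (ii) is Theorem 1.7 (Factorization), the main theorem of the source (named fact
`SchrammSmirnov2011_thm_1_7`).  Half (i) is, in the source, the product structure of the
discrete model ((1.1) p. 4: "when `V` is decomposed into two disjoint subsets, we obviously have
`𝓕_V = 𝓕_{V₁} × 𝓕_{V₂}`") passed to the scaling limit.  This file PROVES half (i), in the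
stronger form "the crossing `σ`-fields of two DISJOINT OPEN sets are independent under every
subsequential scaling limit", with no percolation estimate (no RSW, no continuity of crossing
probabilities): only Theorem 1.4 (proved in the tree, `SchrammSmirnov2011_thm_1_4_holds`), the
locality and measurability of the discrete encoding (`QuadCrossingNoiseDiscrete.lean`) and weak
convergence.

**The argument.**  Fix open `V₁, V₂ ⊆ D` at distance `≥ η > 0`.  By Theorem 1.4 (4) the
restriction maps `rᵢ : ℋ_D → ℋ_{Vᵢ}` are continuous, and by Theorem 1.4 (2) the pull-back of the
Borel `σ`-field of `ℋ_{Vᵢ}` under `rᵢ` is exactly `𝓕_{Vᵢ}` (`comap_restrict_borel_eq_crossingField`).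
At mesh `δ ≤ η/8` the two random configurations `rᵢ(ω_δ)` are measurable with respect to the
states of the edges drawn through the `η/4`-neighbourhoods of `V₁`, resp. `V₂`, two disjoint edge
sets, hence independent under the product measure `P_{1/2}`
(`indepFun_restrict_z2QuadConfig`).  Consequently, for bounded continuous `f : ℋ_{V₁} → ℝ`,
`g : ℋ_{V₂} → ℝ`, `μ_δ[f∘r₁ · g∘r₂] = μ_δ[f∘r₁] μ_δ[g∘r₂]`; all three integrands are bounded
continuous on `ℋ_D`, so the identity passes to any weak limit `μ = lim μ_{δₖ}`, and Mathlib's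
`indepFun_of_bcf` (independence is detected by bounded continuous functions on Borel spaces with
`HasOuterApproxClosed` — `ℋ_{Vᵢ}` is metrizable by Theorem 1.4 (1)) gives `r₁ ⟂ r₂` under `μ`,
i.e. `𝓕_{V₁} ⟂ 𝓕_{V₂}` (`indep_crossingField_of_separated`).  Two disjoint open sets `U₁, U₂`
are exhausted by such pairs (`𝓕_U = ∨ 𝓕_V` over the open `V` with `B(v, η) ⊆ U` for `v ∈ V`,
a directed family), and independence passes to directed suprema
(`indep_crossingField_of_disjoint`).

* `indep_regionField_compl` — for EVERY `W ⊆ ℂ` (not only the rectangle base), `𝓕_{int(D ∩ W)}`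
  and `𝓕_{int(D ∖ W)}` are independent under every subsequential scaling limit in `ℋ_D`, `D` open;
* `SchrammSmirnov2011_cor_1_8_noise_of_generation` — Cor. 1.8 (noise) now reduces to its
  generation half alone (Thm. 1.7 for the cut `D ∩ ∂W`); likewise hypothesis 1 of
  `SchrammSmirnov2011_cor_1_8_black_of_noise` (`QuadCrossingNoiseBlack.lean`), the noise property,
  is used there only through its independence clause, now available as `indep_regionField_compl`.

No definition and no named fact is introduced (D-0026).

## References

* O. Schramm, S. Smirnov, Ann. Probab. 39 (2011) 1768–1814, arXiv:1101.5820: §1.1 (1.1),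
  Thm. 1.4 (1), (2), (4), Cor. 1.8. [SchrammSmirnov2011]
* B. Tsirelson, *Noise as a Boolean algebra of `σ`-fields*, Ann. Probab. 42 (2014), Def. 1.1
  (independence of `x` and `x'`). [Tsirelson2014]
-/

noncomputable section

open scoped Topology BoundedContinuousFunction unitInterval
open Set Filter Metric
open _root_.MeasureTheory _root_.ProbabilityTheory
open Literature.Probability.LatticeModels

namespace Literature.Probability.Percolation

namespace QuadCrossing

variable {D : Set ℂ}

/-! ### The crossing `σ`-field of a subdomain and the restriction map -/

/-- The `σ`-field `𝓕_U` of `QuadCrossingNoise.lean` is the `crossingSubfield U` of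
`QuadCrossingPushforward.lean` (same generators). [folklore] -/
theorem crossingField_eq_crossingSubfield (U : Set ℂ) :
    crossingField (D := D) U = QuadConfig.crossingSubfield U := rfl

/-- `𝓕_V ≤ σ(r_V)`: every crossing event of a quad inside `V` is pulled back from `ℋ_V` by the
restriction `r_V : ℋ_D → ℋ_V` (`V ⊆ D` open). [cite: SchrammSmirnov2011, Thm. 1.4 (4)] -/
theorem crossingField_le_comap_restrict {V : Set ℂ} (hV : IsOpen V) (hVD : V ⊆ D) :
    crossingField (D := D) V ≤
      (QuadConfig.instMeasurableSpace : MeasurableSpace (QuadConfig V)).comap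
        (QuadConfig.restrict hV hVD) := by
  rw [crossingField_eq_crossingSubfield,
    ← QuadConfig.comap_restrict_crossingSubfield hV hVD Subset.rfl]
  exact MeasurableSpace.comap_mono (QuadConfig.crossingSubfield_le_borel _)

/-- **`σ(r_V) = 𝓕_V`** for `V ⊆ D` open nonempty: the Borel `σ`-field of `ℋ_V` is generated by
the crossing events of the quads of `V` (Thm. 1.4 (2)), whose pull-backs under the restriction are
the crossing events in `ℋ_D` of the quads inside `V`. [cite: SchrammSmirnov2011, Thm. 1.4 (2), (4)] -/
theorem comap_restrict_borel_eq_crossingField {V : Set ℂ} (hV : IsOpen V) (hVD : V ⊆ D)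
    (hne : V.Nonempty) :
    (borel (QuadConfig V)).comap (QuadConfig.restrict hV hVD) = crossingField (D := D) V := by
  have h : QuadConfig.crossingSubfield (D := V) univ = QuadConfig.crossingSubfield (D := V) V := by
    rw [← QuadConfig.crossingSubfield_inter, univ_inter]
  rw [← QuadConfig.crossingSubfield_univ_eq_borel SchrammSmirnov2011_thm_1_4_holds hV hne, h,
    QuadConfig.comap_restrict_crossingSubfield hV hVD Subset.rfl, crossingField_eq_crossingSubfield]

/-! ### Discrete independence of the restrictions to two separated open sets -/

/-- **Locality of the restricted encoding.**  At mesh `δ > 0`, the random configuration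
`r_V(ω_δ) ∈ ℋ_V` (`V ⊆ D` open nonempty) is measurable with respect to the states of the lattice
edges drawn through the closed `ε`-neighbourhood of `V` (`ε > 0`): its `σ`-field is generated by
the events `{ω : Q ∈ ω_δ}`, `[Q] ⊆ V`, each determined by those edges
(`determinedBy_preimage_crossedEvent`). [cite: SchrammSmirnov2011, §1.1 (1.1) and §1.3] -/
theorem comap_restrict_z2QuadConfig_le_edgeSigma {V : Set ℂ} (hV : IsOpen V) (hVD : V ⊆ D)
    (hne : V.Nonempty) {δ ε : ℝ} (hδ : 0 < δ) (hε : 0 < ε) :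
    (borel (QuadConfig V)).comap (QuadConfig.restrict hV hVD ∘ z2QuadConfig D δ) ≤
      edgeSigma {e : Sym2 (Site 2) | ∃ x y : Site 2, (zdGraph 2).Adj x y ∧
        (segment ℝ (meshPoint δ x) (meshPoint δ y) ∩ cthickening ε V).Nonempty ∧ e = s(x, y)} := by
  rw [← MeasurableSpace.comap_comp, comap_restrict_borel_eq_crossingField hV hVD hne,
    crossingField, MeasurableSpace.comap_generateFrom]
  refine MeasurableSpace.generateFrom_le ?_
  rintro _ ⟨_, ⟨Q, hQ, rfl⟩, rfl⟩
  refine DeterminedBy.measurableSet_edgeSigma ?_ (measurableSet_preimage_crossedEvent hδ Q)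
  refine determinedBy_preimage_crossedEvent δ Q hε fun x y hxy hxy' => ⟨x, y, hxy, ?_, rfl⟩
  exact hxy'.mono (inter_subset_inter_right _ (cthickening_subset_of_subset ε hQ))

/-- **Discrete independence (Schramm–Smirnov (1.1)).**  If the open sets `V₁, V₂ ⊆ D` are at
distance `≥ η > 0`, then at every mesh `0 < δ ≤ η/8` the restrictions `r_{V₁}(ω_δ)` and
`r_{V₂}(ω_δ)` of the random configuration are independent under `P_{1/2}`: they are measurable
with respect to the edges drawn through the `η/4`-neighbourhoods of `V₁`, resp. `V₂`, two
disjoint sets of edges (`disjoint_setOf_edge_meeting`), and disjoint sets of edges are independent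
under the product measure (`bondPercolation_indep_edgeSigma`).
[cite: SchrammSmirnov2011, §1.1 (1.1) and Cor. 1.8] -/
theorem indepFun_restrict_z2QuadConfig {V₁ V₂ : Set ℂ} (hV₁ : IsOpen V₁) (hV₁D : V₁ ⊆ D)
    (hne₁ : V₁.Nonempty) (hV₂ : IsOpen V₂) (hV₂D : V₂ ⊆ D) (hne₂ : V₂.Nonempty) {η : ℝ}
    (hη : 0 < η) (hsep : ∀ v₁ ∈ V₁, ∀ v₂ ∈ V₂, η ≤ dist v₁ v₂) {δ : ℝ} (hδ : 0 < δ)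
    (hδη : δ ≤ η / 8) :
    IndepFun (QuadConfig.restrict hV₁ hV₁D ∘ z2QuadConfig D δ)
      (QuadConfig.restrict hV₂ hV₂D ∘ z2QuadConfig D δ) (bondPercolation (zdGraph 2) half) := by
  rw [IndepFun_iff_Indep]
  have hdisj : Disjoint (cthickening (2 * δ + η / 4) V₁) (cthickening (η / 4) V₂) := by
    rw [Set.disjoint_left]
    intro w hw₁ hw₂
    have hw₁' : w ∈ thickening (5 * η / 8) V₁ :=
      cthickening_subset_thickening' (by positivity) (by linarith) _ hw₁
    have hw₂' : w ∈ thickening (3 * η / 8) V₂ :=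
      cthickening_subset_thickening' (by positivity) (by linarith) _ hw₂
    obtain ⟨v₁, hv₁, hd₁⟩ := mem_thickening_iff.1 hw₁'
    obtain ⟨v₂, hv₂, hd₂⟩ := mem_thickening_iff.1 hw₂'
    have h := hsep v₁ hv₁ v₂ hv₂
    have h' : dist v₁ v₂ ≤ dist w v₁ + dist w v₂ := dist_triangle_left _ _ _
    linarith
  have hE := disjoint_setOf_edge_meeting (T₁ := V₁) (T₂ := V₂)
    (by positivity : (0 : ℝ) ≤ η / 4) hδ hdisj
  exact indep_of_indep_of_le_right
    (indep_of_indep_of_le_left (bondPercolation_indep_edgeSigma (zdGraph 2) half hE)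
      (comap_restrict_z2QuadConfig_le_edgeSigma hV₁ hV₁D hne₁ hδ (by positivity)))
    (comap_restrict_z2QuadConfig_le_edgeSigma hV₂ hV₂D hne₂ hδ (by positivity))

/-! ### Passing to the scaling limit -/

/-- **The product formula survives the scaling limit.**  For `μ` a subsequential scaling limit in
`ℋ_D` (`D` open), open `V₁, V₂ ⊆ D` at distance `≥ η > 0`, and bounded continuous
`f : ℋ_{V₁} → ℝ`, `g : ℋ_{V₂} → ℝ`:  `μ[f(r₁ ·) g(r₂ ·)] = μ[f(r₁ ·)] · μ[g(r₂ ·)]`.  Indeed the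
three integrands are bounded continuous on `ℋ_D` (Thm. 1.4 (4)), so the three integrals are limits
along `μ_{δₖ}`, and for `δₖ ≤ η/8` the identity holds at mesh `δₖ`
(`indepFun_restrict_z2QuadConfig`). [cite: SchrammSmirnov2011, §1.1 (1.1), Thm. 1.4 (4), Cor. 1.8] -/
theorem integral_mul_restrict_eq_of_isSubseqQuadLimit (hD : IsOpen D)
    {μ : FiniteMeasure (QuadConfig D)} (hμ : IsSubseqQuadLimit D μ) {V₁ V₂ : Set ℂ}
    (hV₁ : IsOpen V₁) (hV₁D : V₁ ⊆ D) (hne₁ : V₁.Nonempty) (hV₂ : IsOpen V₂) (hV₂D : V₂ ⊆ D)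
    (hne₂ : V₂.Nonempty) {η : ℝ} (hη : 0 < η) (hsep : ∀ v₁ ∈ V₁, ∀ v₂ ∈ V₂, η ≤ dist v₁ v₂)
    (f : QuadConfig V₁ →ᵇ ℝ) (g : QuadConfig V₂ →ᵇ ℝ) :
    ∫ ω, f (QuadConfig.restrict hV₁ hV₁D ω) * g (QuadConfig.restrict hV₂ hV₂D ω)
        ∂(μ : Measure (QuadConfig D)) =
      (∫ ω, f (QuadConfig.restrict hV₁ hV₁D ω) ∂(μ : Measure (QuadConfig D))) *
        ∫ ω, g (QuadConfig.restrict hV₂ hV₂D ω) ∂(μ : Measure (QuadConfig D)) := by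
  set r₁ := QuadConfig.restrict hV₁ hV₁D with hr₁_def
  set r₂ := QuadConfig.restrict hV₂ hV₂D with hr₂_def
  have hr₁ : Continuous r₁ := QuadConfig.continuous_restrict hV₁ hV₁D
  have hr₂ : Continuous r₂ := QuadConfig.continuous_restrict hV₂ hV₂D
  obtain ⟨δs, hpos, hδ0, hlim⟩ := (isSubseqQuadLimit_iff D μ).1 hμ
  rw [FiniteMeasure.tendsto_iff_forall_integral_tendsto] at hlim
  set F₁ : QuadConfig D →ᵇ ℝ := f.compContinuous ⟨r₁, hr₁⟩ with hF₁
  set F₂ : QuadConfig D →ᵇ ℝ := g.compContinuous ⟨r₂, hr₂⟩ with hF₂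
  have hF : ∀ ω, (F₁ * F₂) ω = f (r₁ ω) * g (r₂ ω) := fun ω => rfl
  have h1 : ∀ ω, F₁ ω = f (r₁ ω) := fun ω => rfl
  have h2 : ∀ ω, F₂ ω = g (r₂ ω) := fun ω => rfl
  -- at small meshes the discrete laws factor
  have hev : ∀ᶠ k in atTop,
      ∫ ω, (F₁ * F₂) ω ∂(z2QuadLaw D (δs k) : Measure (QuadConfig D)) =
        (∫ ω, F₁ ω ∂(z2QuadLaw D (δs k) : Measure (QuadConfig D))) *
          ∫ ω, F₂ ω ∂(z2QuadLaw D (δs k) : Measure (QuadConfig D)) := by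
    filter_upwards [hδ0.eventually_le_const (show (0 : ℝ) < η / 8 by positivity)] with k hk
    have hS : Measurable (z2QuadConfig D (δs k)) := measurable_z2QuadConfig hD (hpos k)
    have hind := indepFun_restrict_z2QuadConfig (D := D) hV₁ hV₁D hne₁ hV₂ hV₂D hne₂ hη hsep
      (hpos k) hk
    rw [toMeasure_z2QuadLaw, integral_map hS.aemeasurable (F₁ * F₂).continuous.aestronglyMeasurable,
      integral_map hS.aemeasurable F₁.continuous.aestronglyMeasurable,
      integral_map hS.aemeasurable F₂.continuous.aestronglyMeasurable]
    simp only [hF, h1, h2]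
    exact hind.integral_fun_comp_mul_comp (hr₁.measurable.comp hS).aemeasurable
      (hr₂.measurable.comp hS).aemeasurable f.continuous.aestronglyMeasurable
      g.continuous.aestronglyMeasurable
  have hlimF := hlim (F₁ * F₂)
  have hlim12 := (hlim F₁).mul (hlim F₂)
  have heq := tendsto_nhds_unique hlimF (hlim12.congr' (hev.mono fun k hk => hk.symm))
  simpa only [hF, h1, h2] using heq

/-- **Independence of the crossing `σ`-fields of two separated open sets** under every
subsequential scaling limit `μ` in `ℋ_D` (`D` open): if the open nonempty `V₁, V₂ ⊆ D` are at
distance `≥ η > 0` then `𝓕_{V₁}` and `𝓕_{V₂}` are independent under `μ`.  By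
`integral_mul_restrict_eq_of_isSubseqQuadLimit` and Mathlib's `indepFun_of_bcf` (on the Borel
spaces `ℋ_{Vᵢ}`, metrizable by Thm. 1.4 (1)) the restrictions `r₁, r₂` are independent random
variables under `μ`, and `𝓕_{Vᵢ} = σ(rᵢ)`. [cite: SchrammSmirnov2011, Cor. 1.8 (independence, via (1.1) and Thm. 1.4)] -/
theorem indep_crossingField_of_separated (hD : IsOpen D) {μ : FiniteMeasure (QuadConfig D)}
    (hμ : IsSubseqQuadLimit D μ) {V₁ V₂ : Set ℂ} (hV₁ : IsOpen V₁) (hV₁D : V₁ ⊆ D)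
    (hne₁ : V₁.Nonempty) (hV₂ : IsOpen V₂) (hV₂D : V₂ ⊆ D) (hne₂ : V₂.Nonempty) {η : ℝ}
    (hη : 0 < η) (hsep : ∀ v₁ ∈ V₁, ∀ v₂ ∈ V₂, η ≤ dist v₁ v₂) :
    Indep (crossingField V₁) (crossingField V₂) (μ : Measure (QuadConfig D)) := by
  haveI : TopologicalSpace.MetrizableSpace (QuadConfig V₁) :=
    (SchrammSmirnov2011_thm_1_4_holds V₁ hV₁ hne₁).1.2.1
  haveI : TopologicalSpace.MetrizableSpace (QuadConfig V₂) :=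
    (SchrammSmirnov2011_thm_1_4_holds V₂ hV₂ hne₂).1.2.1
  have hr₁ : Continuous (QuadConfig.restrict hV₁ hV₁D) := QuadConfig.continuous_restrict hV₁ hV₁D
  have hr₂ : Continuous (QuadConfig.restrict hV₂ hV₂D) := QuadConfig.continuous_restrict hV₂ hV₂D
  have hind : IndepFun (QuadConfig.restrict hV₁ hV₁D) (QuadConfig.restrict hV₂ hV₂D)
      (μ : Measure (QuadConfig D)) :=
    indepFun_of_bcf hr₁.measurable.aemeasurable hr₂.measurable.aemeasurable fun f g =>
      integral_mul_restrict_eq_of_isSubseqQuadLimit hD hμ hV₁ hV₁D hne₁ hV₂ hV₂D hne₂ hη hsep f g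
  rw [IndepFun_iff_Indep] at hind
  exact indep_of_indep_of_le_right
    (indep_of_indep_of_le_left hind (crossingField_le_comap_restrict hV₁ hV₁D))
    (crossingField_le_comap_restrict hV₂ hV₂D)

/-! ### Exhausting two disjoint open sets by separated pairs -/

/-- The crossing `σ`-field of an open set `U` is covered by those of the open nonempty `V ⊆ D`
kept at a positive distance `η` from the complement of `U` (`B(v, η) ⊆ U` for `v ∈ V`): a quad
inside `U` has a compact carrier, hence a whole neighbourhood inside `U`. [folklore] -/
theorem crossingField_le_iSup_separated (hD : IsOpen D) {U : Set ℂ} (hU : IsOpen U) :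
    crossingField (D := D) U ≤
      ⨆ p : {p : Set ℂ × ℝ // IsOpen p.1 ∧ p.1 ⊆ D ∧ p.1.Nonempty ∧ 0 < p.2 ∧
          ∀ v ∈ p.1, ball v p.2 ⊆ U}, crossingField (D := D) p.1.1 := by
  refine MeasurableSpace.generateFrom_le ?_
  rintro _ ⟨Q, hQ, rfl⟩
  obtain ⟨ε, hε, hεU⟩ := Q.isCompact_carrier.exists_cthickening_subset_open hU hQ
  have hQV : Q.carrier ⊆ thickening (ε / 2) Q.carrier ∩ D :=
    subset_inter (self_subset_thickening (half_pos hε) _) Q.carrier_subset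
  have hp : IsOpen (thickening (ε / 2) Q.carrier ∩ D) ∧ thickening (ε / 2) Q.carrier ∩ D ⊆ D ∧
      (thickening (ε / 2) Q.carrier ∩ D).Nonempty ∧ 0 < ε / 2 ∧
      ∀ v ∈ thickening (ε / 2) Q.carrier ∩ D, ball v (ε / 2) ⊆ U := by
    refine ⟨isOpen_thickening.inter hD, inter_subset_right,
      ⟨Q ((0 : I), (0 : I)), hQV ⟨((0 : I), (0 : I)), rfl⟩⟩, half_pos hε, ?_⟩
    rintro v ⟨hv, -⟩ w hw
    obtain ⟨q, hq, hvq⟩ := mem_thickening_iff.1 hv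
    refine hεU (thickening_subset_cthickening ε _ (mem_thickening_iff.2 ⟨q, hq, ?_⟩))
    calc dist w q ≤ dist w v + dist v q := dist_triangle _ _ _
      _ < ε / 2 + ε / 2 := add_lt_add (mem_ball.1 hw) hvq
      _ = ε := by ring
  have hmeas : MeasurableSet[crossingField (D := D) (thickening (ε / 2) Q.carrier ∩ D)]
      (QuadConfig.crossedEvent Q) := measurableSet_crossingField_crossedEvent hQV
  exact le_iSup (fun p : {p : Set ℂ × ℝ // IsOpen p.1 ∧ p.1 ⊆ D ∧ p.1.Nonempty ∧ 0 < p.2 ∧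
      ∀ v ∈ p.1, ball v p.2 ⊆ U} => crossingField (D := D) p.1.1)
    ⟨(thickening (ε / 2) Q.carrier ∩ D, ε / 2), hp⟩ _ hmeas

/-- **Independence of the crossing `σ`-fields of two disjoint open sets** (the independence half
of Cor. 1.8, for arbitrary disjoint open `U₁, U₂`, under every subsequential scaling limit of
critical bond percolation on `ℤ²` in `ℋ_D`, `D` open): `𝓕_{U₁} ⟂ 𝓕_{U₂}`.  Each `𝓕_{Uᵢ}` is the
directed supremum of the `𝓕_V`, `V` open with `B(v, η) ⊆ Uᵢ` on `V`
(`crossingField_le_iSup_separated`); two such `V₁, V₂` are at distance `≥ η`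
(`U₁ ∩ U₂ = ∅`), hence independent (`indep_crossingField_of_separated`), and independence passes
to directed suprema (`indep_iSup_of_directed_le`).
[cite: SchrammSmirnov2011, Cor. 1.8 (independence, via (1.1) and Thm. 1.4)] -/
theorem indep_crossingField_of_disjoint (hD : IsOpen D) {μ : FiniteMeasure (QuadConfig D)}
    (hμ : IsSubseqQuadLimit D μ) {U₁ U₂ : Set ℂ} (hU₁ : IsOpen U₁) (hU₂ : IsOpen U₂)
    (h12 : Disjoint U₁ U₂) :
    Indep (crossingField U₁) (crossingField U₂) (μ : Measure (QuadConfig D)) := by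
  haveI : IsProbabilityMeasure (μ : Measure (QuadConfig D)) :=
    isProbabilityMeasure_of_isSubseqQuadLimit hD hμ
  -- the separated open subsets of `U`, indexing a directed family of `σ`-fields
  let ι : Set ℂ → Type := fun U => {p : Set ℂ × ℝ // IsOpen p.1 ∧ p.1 ⊆ D ∧ p.1.Nonempty ∧
    0 < p.2 ∧ ∀ v ∈ p.1, ball v p.2 ⊆ U}
  let m : (U : Set ℂ) → ι U → MeasurableSpace (QuadConfig D) := fun U p =>
    crossingField (D := D) p.1.1
  have hdir : ∀ U, Directed (· ≤ ·) (m U) := by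
    intro U p q
    refine ⟨⟨(p.1.1 ∪ q.1.1, min p.1.2 q.1.2), p.2.1.union q.2.1, union_subset p.2.2.1 q.2.2.1,
      p.2.2.2.1.mono subset_union_left, lt_min p.2.2.2.2.1 q.2.2.2.2.1, ?_⟩, ?_, ?_⟩
    · rintro v (hv | hv)
      · exact (ball_subset_ball (min_le_left _ _)).trans (p.2.2.2.2.2 v hv)
      · exact (ball_subset_ball (min_le_right _ _)).trans (q.2.2.2.2.2 v hv)
    · exact crossingField_mono subset_union_left
    · exact crossingField_mono subset_union_right
  have hle : ∀ U (p : ι U),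
      m U p ≤ (QuadConfig.instMeasurableSpace : MeasurableSpace (QuadConfig D)) :=
    fun U p => crossingField_le _
  -- separated pairs are independent
  have hpair : ∀ (p : ι U₁) (q : ι U₂), Indep (m U₁ p) (m U₂ q) (μ : Measure (QuadConfig D)) := by
    intro p q
    refine indep_crossingField_of_separated hD hμ p.2.1 p.2.2.1 p.2.2.2.1 q.2.1 q.2.2.1
      q.2.2.2.1 p.2.2.2.2.1 fun v₁ hv₁ v₂ hv₂ => ?_
    by_contra hlt
    push Not at hlt
    have hv₂U₁ : v₂ ∈ U₁ := p.2.2.2.2.2 v₁ hv₁ (mem_ball.2 (by rwa [dist_comm]))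
    have hv₂U₂ : v₂ ∈ U₂ := q.2.2.2.2.2 v₂ hv₂ (mem_ball_self q.2.2.2.2.1)
    exact Set.disjoint_left.1 h12 hv₂U₁ hv₂U₂
  have h1 : Indep (⨆ p, m U₁ p) (⨆ q, m U₂ q) (μ : Measure (QuadConfig D)) := by
    have h1' : ∀ q : ι U₂, Indep (⨆ p, m U₁ p) (m U₂ q) (μ : Measure (QuadConfig D)) := fun q =>
      indep_iSup_of_directed_le (fun p => hpair p q) (hle U₁) (hle U₂ q) (hdir U₁)
    exact (indep_iSup_of_directed_le (fun q => (h1' q).symm) (hle U₂) (iSup_le (hle U₁))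
      (hdir U₂)).symm
  exact indep_of_indep_of_le_right
    (indep_of_indep_of_le_left h1 (crossingField_le_iSup_separated hD hU₁))
    (crossingField_le_iSup_separated hD hU₂)

/-- **Cor. 1.8, independence on the Boolean base, for every subset `W ⊆ ℂ`**: under every
subsequential scaling limit in `ℋ_D` (`D` open) the `σ`-fields `𝓕_{int(D ∩ W)}` and
`𝓕_{int(D ∖ W)} = 𝓕_{int(D ∩ Wᶜ)}` of the two complementary planar domains are independent
(Tsirelson 2014, Def. 1.1: "for every `x ∈ B` the `σ`-fields `x, x'` are independent").
[cite: SchrammSmirnov2011, Cor. 1.8 (independence half)] -/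
theorem indep_regionField_compl (hD : IsOpen D) {μ : FiniteMeasure (QuadConfig D)}
    (hμ : IsSubseqQuadLimit D μ) (W : Set ℂ) :
    Indep (regionField D W) (regionField D Wᶜ) (μ : Measure (QuadConfig D)) :=
  indep_crossingField_of_disjoint hD hμ isOpen_interior isOpen_interior
    (disjoint_compl_right.mono (interior_subset.trans inter_subset_right)
      (interior_subset.trans inter_subset_right))

/-! ### What remains of Cor. 1.8: reductions with the independence half discharged -/

/-- **Cor. 1.8 (noise) from its generation half alone.**  Given, for `D` open connected, `μ` a
subsequential scaling limit and `W ∈ rectAlgebra`, that the Borel `σ`-field is included in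
`𝓕_{int(D ∩ W)} ∨ 𝓕_{int(D ∖ W)}` up to `μ`-null sets (the content of Thm. 1.7 for the cut
`D ∩ ∂W`), the named fact `SchrammSmirnov2011_cor_1_8_noise` follows: its independence clause is
`indep_regionField_compl`. [cite: SchrammSmirnov2011, Cor. 1.8 and Thm. 1.7] -/
theorem SchrammSmirnov2011_cor_1_8_noise_of_generation
    (hgen : ∀ (D : Set ℂ), IsOpen D → IsConnected D →
      ∀ μ : FiniteMeasure (QuadConfig D), IsSubseqQuadLimit D μ →
        ∀ W ∈ rectAlgebra,
          AEIncluded (μ : Measure (QuadConfig D)) (inferInstance : MeasurableSpace (QuadConfig D))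
            (regionField D W ⊔ regionField D Wᶜ)) :
    SchrammSmirnov2011_cor_1_8_noise :=
  fun D hD hDc μ hμ W hW => ⟨indep_regionField_compl hD hμ W, hgen D hD hDc μ hμ W hW⟩

end QuadCrossing

end Literature.Probability.Percolation
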